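import Summits.ResolutionOfSingularities.ResolutionOfSingularities.Theorems.MarkedTransferCampaignW46Threefolds
import Literature.AlgebraicGeometry.Hironaka2017.InvStringOrder
import Mathlib.AlgebraicGeometry.Morphisms.Finite
import HarnessLib

/-!
# [OURS · L1 W4.6 rung (ii)] THREEFOLD HYPERSURFACES — the REDUCTION PROOF: whole-∇ termination of the typed Th. 16.6
# procedure from the one-step shape plus two structural hypotheses (companion of
# `Theorems/MarkedTransferCampaignW46Threefolds.lean`)

Cell res-hironaka, LADDER-RESOLUTION rung L (D-0089), slot W4.6, rung (ii); seat res-L1-s46-pv-3. Host route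
MarkedTransfer, `--supports stmt-ResolutionOfSingularities-16156` (`HypersurfaceOrderReductionDimLeThree`).

HONEST FRAMING. Every theorem below is PURE LOGIC over the OURS campaign definitions (`CampaignW46.Run`, `Step`,
`DecreaseAlongSteps`, `TerminatesNabla`, `NablaTop`, `OffCentreLocal`, `TerminatesWhole`, `regimeII`, …) together with the
tree's order theory of the typed `Inv`-strings (`Literature.AlgebraicGeometry.Hironaka2017.InvStringOrder`:
well-foundedness of the 0-padded lexicographic order of Eq. (127) under a length bound) and Mathlib's Jacobson-scheme
lemma that morphisms locally of finite type map closed points to closed points (Stacks 01TB). NOTHING here is a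
statement of H. Hironaka's manuscript *Resolution of singularities in positive characteristics* (2017-03-23,
[Hironaka2017]) and nothing here asserts that any statement of it holds: a typed candidate occurs only as the HYPOTHESIS
`h : S16Proof.Thm16_6 …` of `terminatesWhole_of_thm16_6` / `terminatesWholeII_of_thm16_6`. The only external premises
admissible for the campaign (FACT-LIST §A/§B) are not needed. AI review is weaker than expert review. No `sorry`;
axioms standard.

## What is proved (OURS), and what stays open

* `terminatesWhole_of_decrease` (general regime `Rg`): `DecreaseAlongSteps N Rd Rg → NablaTop N Rd Rg →
  OffCentreLocal N Rd Rg → TerminatesWhole N Rd Rg`. THE TERMINATION MECHANISM IS OURS: choose at every stage the closed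
  point `η_k ∈ ∇(E_k)` given by `NablaTop`; along a run whose centre is the whole terminal plat, `D′ = ∅`
  (`Step.dPrime_eq_empty_of_coe_eq`, the content of Th. 16.6 (4)'s «hence `∇′ = ∅`» for the tree's strict transform), so
  Eq. (127) applies at EVERY closed point over the centre, and off the centre the strings are unchanged and strictly
  below the top; hence the top strings strictly decrease (`Step.descent_of_whole`) while `m′ ≤ m`, and the tree's
  `eq127_no_infinite_descent_of_m_le` ends the run. The manuscript prints no such measure (§16.3 p.87 l.19–22 «This is
  easily observed …»; GAP-LEDGER R11); this file supplies one for the case `D = ∇` under named hypotheses.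
* `terminatesWholeII_of_decrease` = the same at `regimeII` (threefold hypersurface states: the binders of stmt-16156 read
  on the state; 16156's conclusion is never used): RUNG (ii) in the form `DecreaseII ∧ NablaTopII ∧ OffCentreLocalII →
  TerminatesWholeII`; `terminatesWholeII_of_thm16_6` = the same with `DecreaseII` supplied by the typed candidate
  `Thm16_6` through the anchor.
* Links: `terminatesWhole_of_terminatesNabla` (the registered ∇-centred rung implies the whole-∇ rung — a whole run is a
  ∇-centred run, `Run.IsWhole.isNablaComponent`), `terminatesWhole_of_terminates`, antitonicity.
* OPEN (recorded, not claimed): the converse direction `… → TerminatesNabla N Rd Rg` for runs through REDUCIBLE terminal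
  plats (a proper component is blown up; by the Eq. (128)-shape the top string need not drop). Besides the three
  hypotheses it needs the typed `Thm16_6_3` shape on `D′`, «`m′ ≤ m`» there, and a component count of `∇(E)` that drops
  along such steps (Noetherian ambient; strict transform of a smooth plat along one of its components) — a separate
  sub-goal for the slot planner.

## References

* `Theorems/MarkedTransferCampaignW46Threefolds.lean` (statement module, this seat); shared module + anchors
  `MarkedTransferCampaignW46TypedProcedure(.Anchors)` (res-L1-type-o1; D1 section after res-L1-s47-dis-1).
* `Literature.AlgebraicGeometry.Hironaka2017.InvStringOrder` [BaaderNipkow1998, §2.4 Thm. 2.4.2]; Mathlib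
  `Scheme.Hom.closePoints_subset_preimage_closedPoints` [Stacks, Tag 01TB].
* H. Hironaka, ms. 2017-03-23: Th. 16.6 p.84 l.4–32; §16.3 p.87 l.10–28 — scope only, under adjudication, not cited
  as fact. [Hironaka2017]
-/

noncomputable section

set_option linter.dupNamespace false -- mandated namespace of this single-conjunct summit

open CategoryTheory AlgebraicGeometry TopologicalSpace

namespace Summit.ResolutionOfSingularities.ResolutionOfSingularities.Theorems

namespace CampaignW46

open Literature.AlgebraicGeometry.Resolution
open Literature.AlgebraicGeometry.Hironaka2017.S02Preliminaries
open Literature.AlgebraicGeometry.Hironaka2017.Datum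
open Literature.AlgebraicGeometry.Hironaka2017.S15ARSchemes
open Literature.AlgebraicGeometry.Hironaka2017.S16Proof
open Literature.AlgebraicGeometry.Hironaka2017.InvStringOrder

universe u

variable {n : ℕ} {p : ℕ} [Fact p.Prime] {K : Type u} [Field K] [CharP K p]

/-! ## Whole-∇ runs are ∇-centred runs; the weak shapes imply the whole-∇ shape -/

section Links

variable {N : Notions.{u} n} {Rd : Reading p K N} {Rg Rg₁ Rg₂ : Regime p K}

/-- Pure logic: in a whole run the centre of every step is the (unique) irreducible component of the terminal plat, so
the step is a ∇-step in the sense of design finding D1 (`IsNablaComponent`). [folklore] -/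
theorem Run.IsWhole.isNablaComponent {r : Run N Rd} (h : r.IsWhole) (k : ℕ) :
    IsNablaComponent (r.R k) (r.step k).D where
  subset_nabla := (r.step k).centre.subset_nabla
  irreducible := (r.step k).centre.irreducible
  maximal _ _ hDS hSn := Set.Subset.antisymm (hSn.trans (h k).symm.subset) hDS

/-- Pure logic: ∇-centred termination (`TerminatesNabla`, the registered «hence terminates» shape) implies whole-∇
termination — a whole run is a ∇-centred run. (The converse is the open component-count step recorded in the module
docstring.) [folklore] -/
theorem terminatesWhole_of_terminatesNabla (h : TerminatesNabla N Rd Rg) : TerminatesWhole N Rd Rg :=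
  fun r hw hRg => h ⟨r.A, r.E, r.R, r.reads, fun k => ⟨r.step k, hw.isNablaComponent k⟩, r.E_succ⟩ hRg

/-- Pure logic: sub-centre termination (`Terminates`, the weak shape) implies whole-∇ termination. [folklore] -/
theorem terminatesWhole_of_terminates (h : Terminates N Rd Rg) : TerminatesWhole N Rd Rg :=
  fun r _ hRg => h r hRg

/-- Pure logic: shrinking the regime weakens whole-∇ termination. [folklore] -/
theorem terminatesWhole_antitone (hle : ∀ A E, Rg₁ A E → Rg₂ A E) (h : TerminatesWhole N Rd Rg₂) :
    TerminatesWhole N Rd Rg₁ :=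
  fun r hw hRg => h r hw fun k => hle _ _ (hRg k)

/-- Pure logic: enlarging the regime strengthens the hypothesis shape `NablaTop`. [folklore] -/
theorem nablaTop_antitone (hle : ∀ A E, Rg₁ A E → Rg₂ A E) (h : NablaTop N Rd Rg₂) : NablaTop N Rd Rg₁ :=
  fun A E R h₁ hRd => h A E R (hle A E h₁) hRd

/-- Pure logic: enlarging the regime strengthens the hypothesis shape `OffCentreLocal`. [folklore] -/
theorem offCentreLocal_antitone (hle : ∀ A E, Rg₁ A E → Rg₂ A E) (h : OffCentreLocal N Rd Rg₂) :
    OffCentreLocal N Rd Rg₁ :=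
  fun A E R h₁ hRd A' s R' hR' => h A E R (hle A E h₁) hRd A' s R' hR'

end Links

/-! ## One step of a whole-∇ run: closed points go down, `D′ = ∅`, and the top string drops -/

section OneStep

variable {N : Notions.{u} n} {Rd : Reading p K N} {Rg : Regime p K}
variable {A A' : AmbientDatum p K} {E : IdealExponent A.Z} {R : Resume N A E}

/-- A step of the typed procedure maps closed points to closed points: `π : Z′ → Z` is a morphism of schemes locally of
finite type over the field `K` (`A′.hom = π ≫ A.hom`, both smooth), and `Z` is a Jacobson space (Mathlib
`Scheme.Hom.closePoints_subset_preimage_closedPoints`, Stacks 01TB). [folklore] -/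
theorem Step.apply_mem_closedPoints (s : Step R A') {ξ' : A'.Z}
    (h : ξ' ∈ Literature.AlgebraicGeometry.Hironaka2017.S02Preliminaries.closedPoints A'.Z) :
    s.π ξ' ∈ Literature.AlgebraicGeometry.Hironaka2017.S02Preliminaries.closedPoints A.Z := by
  haveI := A.smooth
  haveI := A'.smooth
  haveI : JacobsonSpace A.Z := LocallyOfFiniteType.jacobsonSpace A.hom
  haveI : LocallyOfFiniteType (s.π ≫ A.hom) := by
    rw [← s.hom_eq]
    infer_instance
  haveI : LocallyOfFiniteType s.π := locallyOfFiniteType_of_comp s.π A.hom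
  exact s.π.closePoints_subset_preimage_closedPoints h

/-- «`D = ∇` and hence `∇′ = ∅`» (Th. 16.6 (4) p.84 l.29, the typed `U84_1` shape, here a one-line consequence of the
tree's definition of the strict transform as `closure (π⁻¹(∇ ∖ D))`): for a whole step the locus `D′ = ∇′ ∩ π⁻¹(D)`
excluded from Eq. (127) is empty. [folklore] -/
theorem Step.dPrime_eq_empty_of_coe_eq (s : Step R A') (h : (s.D : Set A.Z) = (R.nabla : Set A.Z)) :
    R.mti.DPrime s.π s.D = ∅ := by
  have hn : (R.mti.nabla : Set A.Z) = (s.D : Set A.Z) := h.symm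
  unfold MTIDatum.DPrime MTIDatum.nablaPrime
  rw [hn]
  simp [strictTransformSet]

/-- THE ONE-STEP DESCENT (pure logic over the shapes). From a state `(A, E, R)` in the regime, read by `Rd`, with a
closed point `η ∈ ∇(E)` realising (T1)/(T2) of `NablaTop`, take a WHOLE step `s` (`D = ∇(E)`) and any résumé `R′` of
the transform read by `Rd`; then at every closed point `η′` of `Z′` the `Inv`-string of `R′` is STRICTLY below the top
string of `R`, and `m′ ≤ m`. Case `π η′ ∈ D`: `D′ = ∅`, so Eq. (127) of `DecreaseAlongSteps` applies at `η′` and (T1)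
identifies the string at `π η′` with the top string; «`m′ ≤ m`» is the `LengthLe` half. Case `π η′ ∉ D = ∇`:
`OffCentreLocal` identifies the string of `R′` at `η′` with the string of `R` at the closed point `π η′`, which is
strictly below the top by (T2); equal strings have equal lengths, so `m′ = m`. [folklore] -/
theorem Step.descent_of_whole (hD : DecreaseAlongSteps N Rd Rg) (hL : OffCentreLocal N Rd Rg) (hRg : Rg A E)
    (hRd : Rd A E R) (s : Step R A') (hwhole : (s.D : Set A.Z) = (R.nabla : Set A.Z)) {η : A.Z}
    (hT1 : ∀ ξ : A.Z, ξ ∈ Literature.AlgebraicGeometry.Hironaka2017.S02Preliminaries.closedPoints A.Z →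
      ξ ∈ (R.nabla : Set A.Z) → R.invStr ξ = R.invStr η)
    (hT2 : ∀ ξ : A.Z, ξ ∈ Literature.AlgebraicGeometry.Hironaka2017.S02Preliminaries.closedPoints A.Z →
      ξ ∉ (R.nabla : Set A.Z) → InvString.LexLT (R.invStr ξ) (R.invStr η))
    {E' : IdealExponent A'.Z} (hE' : E' = s.E') (R' : Resume N A' E') (hRd' : Rd A' E' R') {η' : A'.Z}
    (hη' : η' ∈ Literature.AlgebraicGeometry.Hironaka2017.S02Preliminaries.closedPoints A'.Z) :
    InvString.LexLT (R'.invStr η') (R.invStr η) ∧ R'.m ≤ R.m := by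
  subst hE'
  have hζ := s.apply_mem_closedPoints hη'
  by_cases hD' : s.π η' ∈ (s.D : Set A.Z)
  · have hstep := hD A E R hRg hRd A' s R' hRd'
    have hnot : η' ∉ R.mti.DPrime s.π s.D := by
      rw [s.dPrime_eq_empty_of_coe_eq hwhole]
      exact Set.notMem_empty _
    have h127 : Eq127 R.mti (s.π η') R'.mti η' := hstep.1 η' hη' hD' hnot
    have hmle : R'.mti.m ≤ R.mti.m := hstep.2 η' hη' hD' hnot
    have hin : s.π η' ∈ (R.nabla : Set A.Z) := by
      rw [← hwhole]
      exact hD'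
    have e := hT1 _ hζ hin
    refine ⟨?_, hmle⟩
    change InvString.LexLT (R'.invStr η') (R.invStr (s.π η')) at h127
    rwa [e] at h127
  · have e := hL A E R hRg hRd A' s R' hRd' η' hη' hD'
    have hnot : s.π η' ∉ (R.nabla : Set A.Z) := by
      rw [← hwhole]
      exact hD'
    have hlt := hT2 _ hζ hnot
    refine ⟨e ▸ hlt, le_of_eq ?_⟩
    have hlen := congrArg List.length e
    simpa only [Resume.invStr, length_invStr] using hlen

end OneStep

/-! ## The reduction: whole-∇ termination from one-step decrease + the two structural hypotheses -/

section Reduction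

variable {N : Notions.{u} n} {Rd : Reading p K N} {Rg : Regime p K}

/-- **THE REDUCTION THEOREM (general regime; pure logic + the tree's order theory).** If, for states in the regime `Rg`
(notion instance `N`, reading `Rd`): every admitted step satisfies Eq. (127) off `D′` with `m′ ≤ m`
(`DecreaseAlongSteps`), the terminal plat is the top stratum of the `Inv`-string (`NablaTop`), and strings are unchanged
off the centre across renewal (`OffCentreLocal`) — then there is NO infinite whole-∇ run inside `Rg`
(`TerminatesWhole`). Proof: pick at every stage the closed point `η_k ∈ ∇(E_k)` of `NablaTop`; by the one-step descent
the top strings `μ_k = invStr R_k η_k` strictly decrease in the 0-padded order and the numbers of stops `m_k` do not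
increase, so `m_k ≤ m_0`; the tree's `InvStringOrder.eq127_no_infinite_descent_of_m_le` (well-foundedness of
`InvString.LexLT` under a length bound, no bound on the exponents needed) forbids such a sequence. Nothing of the
manuscript is used or asserted; the three hypotheses are explicit. [folklore] -/
theorem terminatesWhole_of_decrease (hD : DecreaseAlongSteps N Rd Rg) (hT : NablaTop N Rd Rg)
    (hL : OffCentreLocal N Rd Rg) : TerminatesWhole N Rd Rg := by
  intro r hw hRg
  choose η hηn hηc hT1 hT2 using fun k => hT (r.A k) (r.E k) (r.R k) (hRg k) (r.reads k)
  have hstep : ∀ k, InvString.LexLT ((r.R (k + 1)).invStr (η (k + 1))) ((r.R k).invStr (η k)) ∧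
      (r.R (k + 1)).m ≤ (r.R k).m :=
    fun k => Step.descent_of_whole hD hL (hRg k) (r.reads k) (r.step k) (hw k) (hT1 k) (hT2 k) (r.E_succ k)
      (r.R (k + 1)) (r.reads (k + 1)) (hηc (k + 1))
  have hm : ∀ k, (r.R k).m ≤ (r.R 0).m := by
    intro k
    induction k with
    | zero => exact le_rfl
    | succ k ih => exact (hstep k).2.trans ih
  exact eq127_no_infinite_descent_of_m_le (r.R 0).m (fun k => (r.A k).Z) (fun k => (r.R k).mti) η
    (fun k => hm k) (fun k => (hstep k).1)

/-- The reduction with the one-step shape supplied by the typed candidate: `S16Proof.Thm16_6 n (primeR N Rd) _` (any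
part-(4) parameter; consumed ONLY as a hypothesis, through the anchor `decreaseAlongSteps_of_thm16_6`) together with
`NablaTop`/`OffCentreLocal` in the regime gives whole-∇ termination in the regime. Nothing of the manuscript is asserted.
[folklore] -/
theorem terminatesWhole_of_thm16_6 [PerfectField K] {pPosiEmptyAt : ∀ {W : Scheme.{u}}, IdealExponent W → W → Prop}
    (h : Thm16_6 (p := p) (K := K) n (primeR N Rd) pPosiEmptyAt) (hT : NablaTop N Rd Rg)
    (hL : OffCentreLocal N Rd Rg) : TerminatesWhole N Rd Rg :=
  terminatesWhole_of_decrease (decreaseAlongSteps_of_thm16_6 N Rd h Rg) hT hL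

end Reduction

/-! ## Rung (ii): threefold hypersurfaces (`regimeII` = the binders of stmt-16156 on the state) -/

section RungII

variable (N : Notions.{u} n) (Rd : Reading p K N)

/-- **RUNG (ii), PROVED FORM.** For the NAMED notion instance `N` and reading `Rd`: the one-step rung `DecreaseII`
(Eq. (127) off `D′` and `m′ ≤ m` for threefold hypersurface states) together with `NablaTopII` and `OffCentreLocalII`
implies `TerminatesWholeII` — the typed Th. 16.6 procedure run with centre = the whole terminal plat admits no infinite
run all of whose stages are hypersurface exponents in an ambient of Krull dimension `≤ 3` (the regime where
MarkedTransfer `HypersurfaceOrderReductionDimLeThree`, stmt-16156, applies; its conclusion is NOT used). [folklore] -/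
theorem terminatesWholeII_of_decrease (hD : DecreaseII N Rd) (hT : NablaTopII N Rd) (hL : OffCentreLocalII N Rd) :
    TerminatesWholeII N Rd :=
  terminatesWhole_of_decrease hD hT hL

/-- Rung (ii) with the one-step shape taken from the typed candidate `S16Proof.Thm16_6` (reading R, any part-(4)
parameter) — AS A HYPOTHESIS: `Thm16_6 → NablaTopII → OffCentreLocalII → TerminatesWholeII`. [folklore] -/
theorem terminatesWholeII_of_thm16_6 [PerfectField K]
    {pPosiEmptyAt : ∀ {W : Scheme.{u}}, IdealExponent W → W → Prop}
    (h : Thm16_6 (p := p) (K := K) n (primeR N Rd) pPosiEmptyAt) (hT : NablaTopII N Rd)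
    (hL : OffCentreLocalII N Rd) : TerminatesWholeII N Rd :=
  terminatesWhole_of_thm16_6 h hT hL

/-- Pure logic: the registered ∇-centred rung `TerminatesNablaII` implies the whole-∇ rung `TerminatesWholeII`.
[folklore] -/
theorem terminatesWholeII_of_terminatesNablaII (h : TerminatesNablaII N Rd) : TerminatesWholeII N Rd :=
  terminatesWhole_of_terminatesNabla h

/-- Pure logic: the one-step rung (ii) is the unrestricted one-step shape restricted (antitonicity in the regime), so in
particular any proof of `DecreaseAlongSteps N Rd Regime.top` — or of the larger regimes `Regime.dimLE 3`,
`Regime.cartier` — yields `DecreaseII N Rd`. [folklore] -/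
theorem decreaseII_of_decreaseAlongSteps {Rg : Regime p K} (hle : ∀ A E, regimeII A E → Rg A E)
    (h : DecreaseAlongSteps N Rd Rg) : DecreaseII N Rd :=
  decreaseAlongSteps_antitone hle h

end RungII

end CampaignW46

end Summit.ResolutionOfSingularities.ResolutionOfSingularities.Theorems

end
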